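import Mathlib
import Summits.Ventures.PercRepro2.A3PendantOFibres
import Summits.Ventures.PercRepro2.A3BetweenDZero

/-!
# (MEANS-a₃) holds when `a₃` is a leaf at a root — the third kernel class theorem of `A3Between`
(blind cell PercRepro2, night-1 g30; proofs/NIGHT1-G30.md §6, NIGHT1-G29.md §5.3 (c) «a₃ a leaf at a root»)

Let `a₃` be a leaf attached to a root (`a₁` or `a₂`) by the edge `f`.  The edge `f` is a root edge at
`a₃`, so p5's root-edge closure of the reduced statement (`RootEdge.A3Between_of_noRootEdge_class'`,
A3BetweenDZero.lean: (MEANS-a₃) at `p` follows from (MEANS-a₃) at every weight vector in which the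
root edges at `a₃` have weight `0`) reduces the class to the weight vectors with `p f = 0`, where the
leaf is absent: every fibre other than `{a₃}` is null (`mW_eq_zero_of_leaf_zero`: a non-singleton
fibre lies in `{f open}`), `m_{a₃} = P(Q) = D`, and the between-term vanishes identically
(`btw_eq_zero_of_null_off_singleton`, `A3Between_of_leaf_zero` — a leaf of weight `0` at ANY vertex).
Hence **`A3Between_pendant_root`** (`ends f = s(a₃, a₁)` or `s(a₃, a₂)`, every weight of the leaf
edge).  Standard axioms.
-/

namespace Summit.Ventures.PercRepro2

open UnionCluster CovForm PendantRoot PendantO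

namespace CovForm

namespace A3Fibre

section ZeroLeaf

variable {V : Type*} {E : Type*} [Fintype V] [DecidableEq V] [Fintype E] [DecidableEq E]
  {R : Type*} [Field R] [LinearOrder R] [IsStrictOrderedRing R]
  {ends : E → Sym2 V} {f : E} {a₃ x : V}

omit [Fintype V] [DecidableEq V] [Fintype E] [DecidableEq E] in
/-- A fibre other than `{a₃}` lies in `{f open}` at a leaf `a₃` at `x`. -/
lemma fibre_subset_openEdge_of_ne (hf : ends f = s(a₃, x)) (hleaf : ∀ e, a₃ ∈ ends e → e = f)
    (h3x : a₃ ≠ x) (a₁ a₂ : V) {W : Finset V} (hW : W ≠ {a₃}) :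
    fibre ends a₁ a₂ a₃ W ⊆ openEdge f := by
  intro ω hω
  simp only [fibre, Set.mem_inter_iff, mem_clusterEvent] at hω
  simp only [openEdge, Set.mem_setOf_eq]
  cases h : ω f
  · exfalso
    apply hW
    apply Finset.coe_injective
    rw [← hω.2, cluster_leaf_closed hf hleaf h3x h]
  · rfl

omit [Fintype V] [DecidableEq V] in
/-- At a leaf of weight `0`, every fibre other than `{a₃}` is null. -/
lemma mW_eq_zero_of_leaf_zero {p : E → R} (hp : IsProbVec p) (hf : ends f = s(a₃, x))
    (hleaf : ∀ e, a₃ ∈ ends e → e = f) (h3x : a₃ ≠ x) (hpf : p f = 0) (a₁ a₂ : V) {W : Finset V}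
    (hW : W ≠ {a₃}) : mW p ends a₁ a₂ a₃ W = 0 := by
  unfold mW
  have h1 := prob_mono hp (fibre_subset_openEdge_of_ne hf hleaf h3x a₁ a₂ hW)
  rw [prob_openEdge, hpf] at h1
  exact le_antisymm h1 (prob_nonneg hp _)

/-- When every fibre other than `{a₃}` is null and `m_{a₃} = P(Q) = D`, the between-term vanishes. -/
lemma btw_eq_zero_of_null_off_singleton {p : E → R} (hp : IsProbVec p) (ends : E → Sym2 V)
    (o a₁ a₂ a₃ b : V) (hnull : ∀ W : Finset V, W ≠ {a₃} → mW p ends a₁ a₂ a₃ W = 0)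
    (hm : mW p ends a₁ a₂ a₃ {a₃} = prob p (avoidAll ends a₂ {a₁}))
    (hD : prob p (PDEvent ends a₁ a₂ a₃) = prob p (avoidAll ends a₂ {a₁}))
    (h31 : a₃ ≠ a₁) (h32 : a₃ ≠ a₂) :
    btw p ends o a₁ a₂ a₃ b = 0 := by
  unfold btw
  have e1 : ∑ W : Finset V, Ssig p ends a₁ a₂ a₃ b W * SF p ends o a₁ a₂ a₃ W / mW p ends a₁ a₂ a₃ W =
      Ssig p ends a₁ a₂ a₃ b {a₃} * SF p ends o a₁ a₂ a₃ {a₃} / mW p ends a₁ a₂ a₃ {a₃} := by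
    apply Finset.sum_eq_single
    · intro W _ hW
      rw [Ssig_eq_zero_of_mW_eq_zero hp ends a₁ a₂ a₃ b W (hnull W hW)]
      simp
    · intro h; exact absurd (Finset.mem_univ _) h
  have e2 : ∑ W : Finset V, Ssig p ends a₁ a₂ a₃ b W = Ssig p ends a₁ a₂ a₃ b {a₃} := by
    apply Finset.sum_eq_single
    · intro W _ hW; exact Ssig_eq_zero_of_mW_eq_zero hp ends a₁ a₂ a₃ b W (hnull W hW)
    · intro h; exact absurd (Finset.mem_univ _) h
  have e3 : ∑ W : Finset V, SF p ends o a₁ a₂ a₃ W = SF p ends o a₁ a₂ a₃ {a₃} := by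
    apply Finset.sum_eq_single
    · intro W _ hW; exact SF_eq_zero_of_mW_eq_zero hp ends o a₁ a₂ a₃ W (hnull W hW)
    · intro h; exact absurd (Finset.mem_univ _) h
  have hA : ({a₃} : Finset V) ∈ fibresA a₁ a₂ := by
    rw [fibresA, Finset.mem_filter]
    exact ⟨Finset.mem_univ _, by simp [Finset.mem_singleton, Ne.symm h31, Ne.symm h32]⟩
  have e4 : ∑ W ∈ fibresA a₁ a₂, Su p ends a₁ a₂ a₃ b W * Su p ends a₁ a₂ a₃ o W / mW p ends a₁ a₂ a₃ W =
      Su p ends a₁ a₂ a₃ b {a₃} * Su p ends a₁ a₂ a₃ o {a₃} / mW p ends a₁ a₂ a₃ {a₃} := by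
    apply Finset.sum_eq_single
    · intro W _ hW
      rw [Su_eq_zero_of_mW_eq_zero hp ends a₁ a₂ a₃ b W (hnull W hW)]
      simp
    · intro h; exact absurd hA h
  have e5 : ∑ W ∈ fibresA a₁ a₂, Su p ends a₁ a₂ a₃ b W = Su p ends a₁ a₂ a₃ b {a₃} := by
    apply Finset.sum_eq_single
    · intro W _ hW; exact Su_eq_zero_of_mW_eq_zero hp ends a₁ a₂ a₃ b W (hnull W hW)
    · intro h; exact absurd hA h
  have e6 : ∑ W ∈ fibresA a₁ a₂, Su p ends a₁ a₂ a₃ o W = Su p ends a₁ a₂ a₃ o {a₃} := by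
    apply Finset.sum_eq_single
    · intro W _ hW; exact Su_eq_zero_of_mW_eq_zero hp ends a₁ a₂ a₃ o W (hnull W hW)
    · intro h; exact absurd hA h
  rw [e1, e2, e3, e4, e5, e6, hm, hD]
  ring

/-- **(MEANS-a₃) at a leaf of weight `0` at any vertex `x`** (the leaf is absent). -/
theorem A3Between_of_leaf_zero {p : E → R} (hp : IsProbVec p) (hf : ends f = s(a₃, x))
    (hleaf : ∀ e, a₃ ∈ ends e → e = f) (h3x : a₃ ≠ x) (hpf : p f = 0) {o a₁ a₂ b : V}
    (h31 : a₃ ≠ a₁) (h32 : a₃ ≠ a₂) : A3Between p ends o a₁ a₂ a₃ b := by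
  unfold A3Between
  have hm : mW p ends a₁ a₂ a₃ {a₃} = prob p (avoidAll ends a₂ {a₁}) := by
    rw [mW_singleton_leaf p hf hleaf h3x h31 h32, hpf]
    ring
  have hD : prob p (PDEvent ends a₁ a₂ a₃) = prob p (avoidAll ends a₂ {a₁}) := by
    rw [prob_PD_o p hf hleaf h3x h31 h32, hpf]
    ring
  have hnull : ∀ W : Finset V, W ≠ {a₃} → mW p ends a₁ a₂ a₃ W = 0 :=
    fun W hW => mW_eq_zero_of_leaf_zero hp hf hleaf h3x hpf a₁ a₂ hW
  rw [btw_eq_zero_of_null_off_singleton hp ends o a₁ a₂ a₃ b hnull hm hD h31 h32]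

end ZeroLeaf

section Root

variable {V : Type*} {E : Type*} [Fintype V] [DecidableEq V] [Fintype E] [DecidableEq E]
  {R : Type*} [Field R] [LinearOrder R] [IsStrictOrderedRing R]
  {ends : E → Sym2 V} {f : E} {a₃ : V}

/-- **(MEANS-a₃) at a leaf `a₃` attached to a root, at every weight of the leaf edge**: p5's root-edge
closure reduces it to the weight-`0` leaf, where the between-term vanishes. -/
theorem A3Between_pendant_root {p : E → R} (hp : IsProbVec p) {a₁ a₂ : V}
    (hf : ends f = s(a₃, a₁) ∨ ends f = s(a₃, a₂)) (hleaf : ∀ e, a₃ ∈ ends e → e = f)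
    (h31 : a₃ ≠ a₁) (h32 : a₃ ≠ a₂) (o b : V) : A3Between p ends o a₁ a₂ a₃ b := by
  refine RootEdge.A3Between_of_noRootEdge_class' p hp ends o a₁ a₂ a₃ b fun p' hp' hn => ?_
  have hroot : RootEdge.IsRootEdge ends a₁ a₂ a₃ f := by
    unfold RootEdge.IsRootEdge
    rcases hf with h | h
    · exact Or.inr (Or.inl h)
    · exact Or.inr (Or.inr (Or.inr h))
  have hpf : p' f = 0 := hn f hroot
  rcases hf with h | h
  · exact A3Between_of_leaf_zero hp' h hleaf h31 hpf h31 h32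
  · exact A3Between_of_leaf_zero hp' h hleaf h32 hpf h31 h32

end Root

end A3Fibre

end CovForm

end Summit.Ventures.PercRepro2
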